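import Summits.RiemannHypothesis.RiemannHypothesis.Theorems.XiDiscComparison
import HarnessLib

/-!
# `XiDiscComparison` and `ModulusTest` (idea-2 g3, typed verbatim) — DISCHARGED (RH-FREE)

LINE 1 / LABEL: `XiDiscComparison` and `ModulusTest c` for `c ≥ 1/(2√2)` are RH-FREE and PROVED
here (from `Summit.RiemannHypothesis.RiemannHypothesis.Theorems.XiDiscComparison.norm_riemannXi_lt_of_disc`);
«`∀ c > 0, ModulusTest c`» is RH-EQUIVALENT (Sondow–Dumitrescu, tree
`SondowDumitrescu2010.riemannHypothesis_iff_norm_riemannXi_strictMonoOn`) and is NOT claimed;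
nothing here is progress toward RH. bears_on: LADDER-RH B-P(P2)/(P3) (cell rh-dbr, theory TARGET-v9
§M.3 T1). WHAT THIS IS NOT: not a de Branges/Suzuki positivity statement; the PHASE shadow
`DeBrangesShift.RatioTestSomeScale` (expected false at every scale) is untouched.

The two `Prop`s are the statements of rh-dbr-idea-2 g3's sketch
(`HOME/rh-dbr-idea-2/g3-Sketch.lean`, namespace `…Sketches.ConreyLiModulusFace`), typed verbatim so
that the cell's target T1 is closed BY NAME:

* `XiDiscComparison` — on a horizontal line, `‖ξ‖` is larger at the point farther from the
  critical line as soon as the two squared distances sum to at least `½`;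
* `ModulusTest c` — `‖ξ(s)‖ < ‖ξ(s+2c)‖` for `Re s > ½`;
* `xiDiscComparison_holds`, `modulusTest_of_disc` (idea-2 g3's reduction, verbatim),
  `modulusTest_holds` (`c ≥ 1/(2√2)`).
-/

noncomputable section

set_option linter.dupNamespace false

open Complex

namespace Summit.RiemannHypothesis.RiemannHypothesis.Theorems.XiDiscComparison

open Literature.NumberTheory.LFunctions

/-- RH-FREE (idea-2 g3, typed verbatim; pair-by-pair in the Hadamard product of `ξ`). The disc
comparison: on a horizontal line, `‖ξ‖` is larger at the point farther from the critical line as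
soon as the two squared distances sum to at least `½`. PROVED: `xiDiscComparison_holds`. -/
def XiDiscComparison : Prop :=
  ∀ σ₁ σ₂ t : ℝ, |σ₁ - 1 / 2| < |σ₂ - 1 / 2| → 1 / 2 ≤ (σ₁ - 1 / 2) ^ 2 + (σ₂ - 1 / 2) ^ 2 →
    ‖riemannXi ((σ₁ : ℂ) + t * I)‖ < ‖riemannXi ((σ₂ : ℂ) + t * I)‖

/-- The one-sided MODULUS test at scale `c` (idea-2 g3, typed verbatim): the modulus shadow of
de Branges' ratio `ξ(s+2c)/ξ(s)` on `Re s > 1/2`. RH-FREE and PROVED for `c ≥ 1/(2√2)`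
(`modulusTest_holds`); `∀ c > 0` ⟺ RH (not claimed). -/
def ModulusTest (c : ℝ) : Prop :=
  ∀ s : ℂ, 1 / 2 < s.re → ‖riemannXi s‖ < ‖riemannXi (s + 2 * c)‖

/-- **`XiDiscComparison` holds** (RH-FREE; `norm_riemannXi_lt_of_disc`). -/
theorem xiDiscComparison_holds : XiDiscComparison :=
  fun σ₁ σ₂ t h1 h2 ↦ norm_riemannXi_lt_of_disc σ₁ σ₂ t h1 h2

/-- idea-2 g3's reduction (verbatim): `c ≥ 1/(2√2)` puts the ray `((σ−½)², (σ+2c−½)²)`, `σ > ½`,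
outside the disc, so the disc comparison gives the modulus test at scale `c`. -/
theorem modulusTest_of_disc (hD : XiDiscComparison) {c : ℝ} (hc : 1 / (2 * Real.sqrt 2) ≤ c) :
    ModulusTest c := by
  intro s hs
  have hsqrt : 0 < Real.sqrt 2 := Real.sqrt_pos.mpr (by norm_num)
  have hc0 : 0 < c := lt_of_lt_of_le (by positivity) hc
  have h8 : 1 / 2 ≤ 4 * c ^ 2 := by
    have h1 : 1 ≤ 2 * Real.sqrt 2 * c := by
      have := mul_le_mul_of_nonneg_left hc (le_of_lt (by positivity : (0:ℝ) < 2 * Real.sqrt 2))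
      rwa [mul_one_div_cancel (ne_of_gt (by positivity : (0:ℝ) < 2 * Real.sqrt 2))] at this
    have h2 : (2 * Real.sqrt 2 * c) ^ 2 = 8 * c ^ 2 := by
      have : Real.sqrt 2 ^ 2 = 2 := Real.sq_sqrt (by norm_num)
      nlinarith [this]
    nlinarith [h1, h2, sq_nonneg (2 * Real.sqrt 2 * c - 1)]
  have key := hD s.re (s.re + 2 * c) s.im
    (by rw [abs_of_pos (by linarith), abs_of_pos (by linarith)]; linarith)
    (by nlinarith [sq_nonneg (s.re - 1 / 2), mul_pos hc0 (by linarith : (0:ℝ) < s.re - 1 / 2)])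
  have e1 : ((s.re : ℂ) + s.im * I) = s := Complex.re_add_im s
  have e2 : (((s.re + 2 * c : ℝ) : ℂ) + s.im * I) = s + 2 * c := by
    apply Complex.ext <;> simp
  rw [e1] at key
  rw [e2] at key
  exact key

/-- **The modulus test holds at every scale `c ≥ 1/(2√2)`** (RH-FREE). -/
theorem modulusTest_holds {c : ℝ} (hc : 1 / (2 * Real.sqrt 2) ≤ c) : ModulusTest c :=
  modulusTest_of_disc xiDiscComparison_holds hc

end Summit.RiemannHypothesis.RiemannHypothesis.Theorems.XiDiscComparison
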